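import Literature.MathematicalPhysics.QuantumFieldTheory.Balaban1983to89.B7Prop2Explicit
import HarnessLib

/-!
# T⁴ programme, node NE3 — the kinematic refinement lemma, abelian line, file 1: BLOCK COORDINATES AND THE SLICE
# PULLBACK of a coarse configuration (`SmoothRefineBlocks`)

Cell `pub-balaban`, NE3 formalisation swarm (`t4/formal/NE3/LEAVES.md` row S4b, unit
`b2b-balaban-t4-ne3-formalise-leaf-10`).  Skeleton `t4/b2b-balaban-t4-ne3-p1/SKELETON-NE3-P1.md` v1.1 §3 (leaves R1/R2 of
the kinematic shape `MinimalActionRefine.SmoothRefine`: «a slowly varying small field on the `η`-lattice IS the exact block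
average (42) of a slowly varying small field on the `η/L`-lattice»).

PURE LATTICE BOOKKEEPING, valid for configurations with values in ANY group `G` (nothing abelian yet, nothing analytic):
§1 block coordinates of a fine site `y = L•z + ρ`, `z = blk L y = ⌊y/L⌋`, `ρ = res L y ∈ [0,L)^d` (Euclidean division
coordinatewise), their behaviour under the unit steps `y ↦ y + e_μ` and under coarse translations;
§2 `steps x w` — the list of bonds traversed by the word `w` read from `x`, with the congruence principle
`hol V x w = hol V′ x w` (resp. `= 1`) when the two configurations agree (resp. are trivial) on the traversed bonds, and the
two geometric facts used by every later file: the straight segment `seg κ n` and the tree contour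
`treeWord v` (`v ≥ 0`, B5 (1.7)) read from `x` traverse only forward bonds `⟨y, y + e_κ⟩` with `x ≤ y`, `y + e_κ ≤ x + v`;
§3 THE SLICE PULLBACK `slicePull L U` of a coarse configuration `U`: the fine bond `⟨y, y + e_μ⟩` carries `U ⌊y/L⌋ μ` when it
is the LAST bond of its block in direction `μ` (`res L y μ = L − 1`, i.e. it crosses into the next block) and `1` otherwise —
the pullback of `U` along the block map `y ↦ ⌊y/L⌋` — and its additive twin `sliceLift L ψ` for cochains;
the sequel `SmoothRefineSlices` reads the words of Bałaban's average (42) and the fine plaquettes on these pullbacks.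

HONEST FRAMING: finite-`T⁴` kinematics of block averaging (rung (B)+1 of the cell's ladder: existence/uniqueness of the
`ε → 0` limit of gauge-invariant observables on a FIXED finite torus — NOT infinite volume, NOT a mass gap, NOT the Clay
problem); nothing here is an estimate, nothing of NE3 is claimed; no `BetaPertH`, no (B), no G-an2-4.  No printed sentence
is a hypothesis of anything.  PLACEMENT (human rule 2026-08-19): our work, under `Summits/QuantumFields/BalabanUV/`.
-/

set_option autoImplicit false

open scoped BigOperators

namespace Summit.QuantumFields.BalabanUV.T4Continuum.SmoothRefineBlocks

open Literature.MathematicalPhysics.QuantumFieldTheory.Balaban1983to89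
open B7Prop1Explicit B7Prop2Explicit

noncomputable section

variable {d : ℕ}


/-! ## §1 Block coordinates -/

/-- The block of a fine site: `blk L y = ⌊y/L⌋` coordinatewise (Euclidean division; the same formula as the β-cell's
`Beta.AveragingContours.blk`, kept local to B7's vocabulary `B7Prop1Explicit.{Site, boxVec}`). [folklore] -/
def blk (L : ℕ) (y : Site d) : Site d := fun i => y i / (L : ℤ)

/-- The offset of a fine site in its block: `res L y = y mod L ∈ [0, L)^d` coordinatewise. [folklore] -/
def res (L : ℕ) (y : Site d) : Site d := fun i => y i % (L : ℤ)

/-- `y = L • blk L y + res L y`. [folklore] -/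
theorem blk_add_res (L : ℕ) (y : Site d) : (L : ℤ) • blk L y + res L y = y := by
  ext i
  simp only [blk, res, Pi.add_apply, Pi.smul_apply, smul_eq_mul]
  exact Int.mul_ediv_add_emod (y i) L

/-- `0 ≤ res L y i`. [folklore] -/
theorem res_nonneg {L : ℕ} (hL : 1 ≤ L) (y : Site d) (i : Fin d) : 0 ≤ res L y i :=
  Int.emod_nonneg _ (by exact_mod_cast (by omega : L ≠ 0))

/-- `res L y i < L`. [folklore] -/
theorem res_lt {L : ℕ} (hL : 1 ≤ L) (y : Site d) (i : Fin d) : res L y i < L :=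
  Int.emod_lt_of_pos _ (by exact_mod_cast (by omega : 0 < L))

/-- `res L y i ≤ L − 1`. [folklore] -/
theorem res_le {L : ℕ} (hL : 1 ≤ L) (y : Site d) (i : Fin d) : res L y i ≤ (L : ℤ) - 1 := by
  have := res_lt hL y i; omega

/-- Uniqueness of block coordinates: if `y = L•z + ρ` with `0 ≤ ρ < L` then `blk L y = z` and `res L y = ρ`. [folklore] -/
theorem blk_res_eq_of {L : ℕ} (hL : 1 ≤ L) {y z ρ : Site d} (h : (L : ℤ) • z + ρ = y) (h0 : ∀ i, 0 ≤ ρ i)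
    (h1 : ∀ i, ρ i < L) : blk L y = z ∧ res L y = ρ := by
  have hL0 : (0 : ℤ) < L := by exact_mod_cast (by omega : 0 < L)
  have key : ∀ i, y i / (L : ℤ) = z i ∧ y i % (L : ℤ) = ρ i := fun i =>
    (Int.ediv_emod_unique hL0).2 ⟨by
      have := congr_fun h i
      simp only [Pi.add_apply, Pi.smul_apply, smul_eq_mul] at this
      linarith, h0 i, h1 i⟩
  exact ⟨funext fun i => (key i).1, funext fun i => (key i).2⟩

/-- The block of a block point plus a box offset is the block point. [folklore] -/
theorem blk_boxVec {L : ℕ} (hL : 1 ≤ L) (z : Site d) (r : Fin d → Fin L) :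
    blk L ((L : ℤ) • z + boxVec L r) = z :=
  (blk_res_eq_of hL rfl (fun i => by simp [boxVec]) (fun i => by
    simp only [boxVec, Nat.cast_lt]; exact (r i).isLt)).1

/-- The offset of a block point plus a box offset is the box offset. [folklore] -/
theorem res_boxVec {L : ℕ} (hL : 1 ≤ L) (z : Site d) (r : Fin d → Fin L) :
    res L ((L : ℤ) • z + boxVec L r) = boxVec L r :=
  (blk_res_eq_of hL rfl (fun i => by simp [boxVec]) (fun i => by
    simp only [boxVec, Nat.cast_lt]; exact (r i).isLt)).2

/-- Block coordinates of a block corner: `blk L (L • z) = z` and `res L (L • z) = 0` (the first half is the β-cell's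
`Beta.AxialProjector.blk_zsmul` for its own copy `Beta.AveragingContours.blk` of the same formula; that module is not
imported here, to keep the NE3 support files free of the β-cell's import closure). [folklore] -/
theorem blk_res_smul {L : ℕ} (hL : 1 ≤ L) (z : Site d) : blk L ((L : ℤ) • z) = z ∧ res L ((L : ℤ) • z) = 0 :=
  blk_res_eq_of (y := (L : ℤ) • z) (ρ := 0) hL (add_zero _) (fun _ => le_rfl)
    (fun _ => by simp only [Pi.zero_apply]; exact_mod_cast (by omega : 0 < L))

/-- The offset as an element of `[0, L)^d`. [folklore] -/
def resFin {L : ℕ} (hL : 1 ≤ L) (y : Site d) : Fin d → Fin L := fun i =>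
  ⟨(res L y i).toNat, by
    have h0 := res_nonneg hL y i
    have h1 := res_lt hL y i
    omega⟩

/-- `boxVec L (resFin hL y) = res L y`. [folklore] -/
theorem boxVec_resFin {L : ℕ} (hL : 1 ≤ L) (y : Site d) : boxVec L (resFin hL y) = res L y := by
  ext i
  simp only [boxVec, resFin]
  exact Int.toNat_of_nonneg (res_nonneg hL y i)

/-- Every fine site is a block point plus a box offset: `y = L • blk L y + boxVec L (resFin hL y)`. [folklore] -/
theorem eq_blk_add_boxVec {L : ℕ} (hL : 1 ≤ L) (y : Site d) :
    y = (L : ℤ) • blk L y + boxVec L (resFin hL y) := by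
  rw [boxVec_resFin, blk_add_res]

/-- One unit step in direction `μ`, seen in block coordinates: the block advances by `e_μ` exactly when the step
crosses the last slice (`res L y μ = L − 1`), and the offset wraps to `0` there. [folklore] -/
theorem blk_res_add_e {L : ℕ} (hL : 1 ≤ L) (y : Site d) (μ : Fin d) :
    blk L (y + e μ) = blk L y + (if res L y μ = (L : ℤ) - 1 then e μ else 0) ∧
      res L (y + e μ) = (if res L y μ = (L : ℤ) - 1 then res L y - ((L : ℤ) - 1) • e μ else res L y + e μ) := by
  have hL0 : (0 : ℤ) < L := by exact_mod_cast (by omega : 0 < L)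
  by_cases h : res L y μ = (L : ℤ) - 1
  · simp only [h, ↓reduceIte]
    refine blk_res_eq_of hL ?_ (fun i => ?_) (fun i => ?_)
    · ext i
      have hyi := congr_fun (blk_add_res L y) i
      simp only [Pi.add_apply, Pi.smul_apply, smul_eq_mul, Pi.sub_apply, e_apply] at hyi ⊢
      split_ifs <;> linear_combination hyi
    · simp only [Pi.sub_apply, Pi.smul_apply, smul_eq_mul, e_apply]
      split_ifs with hi
      · subst hi; rw [h]; ring_nf; rfl
      · simp only [mul_zero, sub_zero]; exact res_nonneg hL y i
    · simp only [Pi.sub_apply, Pi.smul_apply, smul_eq_mul, e_apply]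
      split_ifs with hi
      · subst hi; rw [h]; ring_nf; exact hL0
      · simp only [mul_zero, sub_zero]; exact res_lt hL y i
  · simp only [h, ↓reduceIte, add_zero]
    have hlt : res L y μ + 1 < L := by
      have := res_le hL y μ
      omega
    refine blk_res_eq_of hL ?_ (fun i => ?_) (fun i => ?_)
    · rw [← add_assoc, blk_add_res]
    · simp only [Pi.add_apply, e_apply]
      split_ifs
      · have := res_nonneg hL y i; omega
      · simp only [add_zero]; exact res_nonneg hL y i
    · simp only [Pi.add_apply, e_apply]
      split_ifs with hi
      · subst hi; exact hlt
      · simp only [add_zero]; exact res_lt hL y i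

/-- The block after one unit step. [folklore] -/
theorem blk_add_e {L : ℕ} (hL : 1 ≤ L) (y : Site d) (μ : Fin d) :
    blk L (y + e μ) = blk L y + (if res L y μ = (L : ℤ) - 1 then e μ else 0) :=
  (blk_res_add_e hL y μ).1

/-- The offset in direction `μ` after one unit step in direction `μ`. [folklore] -/
theorem res_add_e_self {L : ℕ} (hL : 1 ≤ L) (y : Site d) (μ : Fin d) :
    res L (y + e μ) μ = if res L y μ = (L : ℤ) - 1 then 0 else res L y μ + 1 := by
  rw [(blk_res_add_e hL y μ).2]
  split_ifs with h
  · simp [h, e_apply]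
  · simp [e_apply]

/-- The offsets in the other directions are unchanged by a unit step in direction `μ`. [folklore] -/
theorem res_add_e_ne {L : ℕ} (hL : 1 ≤ L) (y : Site d) {μ ν : Fin d} (h : ν ≠ μ) :
    res L (y + e μ) ν = res L y ν := by
  rw [(blk_res_add_e hL y μ).2]
  split_ifs <;> simp [e_apply, h]

/-- The block coordinates in the other directions are unchanged by a unit step in direction `μ`. [folklore] -/
theorem blk_add_e_ne {L : ℕ} (hL : 1 ≤ L) (y : Site d) {μ ν : Fin d} (h : ν ≠ μ) :
    blk L (y + e μ) ν = blk L y ν := by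
  rw [blk_add_e hL]
  split_ifs <;> simp [e_apply, h]

/-- A coarse translation by `P` blocks in direction `κ` shifts the block and keeps the offset. [folklore] -/
theorem blk_res_add_period {L : ℕ} (hL : 1 ≤ L) (y : Site d) (P : ℤ) (κ : Fin d) :
    blk L (y + ((L : ℤ) * P) • e κ) = blk L y + P • e κ ∧ res L (y + ((L : ℤ) * P) • e κ) = res L y := by
  refine blk_res_eq_of hL ?_ (res_nonneg hL y) (res_lt hL y)
  rw [smul_add, add_right_comm, blk_add_res, smul_smul]

/-! ## §2 Bonds traversed by a word -/

/-- The bonds traversed by the word `w` read from `x`, as the list of pairs (site, letter read there). [folklore] -/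
def steps : Site d → List (Letter d) → List (Site d × Letter d)
  | _, [] => []
  | x, l :: w => (x, l) :: steps (x + l.vec) w

/-- `steps` of the empty word. [folklore] -/
@[simp] theorem steps_nil (x : Site d) : steps x ([] : List (Letter d)) = [] := rfl

/-- `steps` of a word with a first letter. [folklore] -/
@[simp] theorem steps_cons (x : Site d) (l : Letter d) (w : List (Letter d)) :
    steps x (l :: w) = (x, l) :: steps (x + l.vec) w := rfl

/-- `steps` of a concatenation. [folklore] -/
theorem steps_append : ∀ (x : Site d) (w₁ w₂ : List (Letter d)),
    steps x (w₁ ++ w₂) = steps x w₁ ++ steps (x + disp w₁) w₂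
  | x, [], w₂ => by simp
  | x, l :: w₁, w₂ => by
    rw [List.cons_append, steps_cons, steps_cons, steps_append (x + l.vec) w₁ w₂, disp_cons, add_assoc,
      List.cons_append]

section Group

variable {G : Type*} [Group G]

/-- CONGRUENCE: two configurations that agree on every traversed bond have the same transporter. [folklore] -/
theorem hol_congr_of_steps (V V' : Site d → Fin d → G) :
    ∀ (x : Site d) (w : List (Letter d)),
      (∀ s ∈ steps x w, stepHol V s.1 s.2 = stepHol V' s.1 s.2) → hol V x w = hol V' x w
  | _, [], _ => rfl
  | x, l :: w, h => by
    rw [hol_cons, hol_cons, h (x, l) (by simp), hol_congr_of_steps V V' (x + l.vec) w fun s hs =>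
      h s (by simp [hs])]

/-- A configuration trivial on every traversed bond has trivial transporter. [folklore] -/
theorem hol_eq_one_of_steps (V : Site d → Fin d → G) :
    ∀ (x : Site d) (w : List (Letter d)), (∀ s ∈ steps x w, stepHol V s.1 s.2 = 1) → hol V x w = 1
  | _, [], _ => rfl
  | x, l :: w, h => by
    rw [hol_cons, h (x, l) (by simp), one_mul, hol_eq_one_of_steps V (x + l.vec) w fun s hs => h s (by simp [hs])]

end Group

section Additive

variable {X : Type*} [NormedRing X]

/-- A cochain vanishing on every traversed bond has vanishing contour sum. [folklore] -/
theorem asum_eq_zero_of_steps (A : Site d → Fin d → X) :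
    ∀ (x : Site d) (w : List (Letter d)), (∀ s ∈ steps x w, stepA A s.1 s.2 = 0) → asum A x w = 0
  | _, [], _ => rfl
  | x, l :: w, h => by
    rw [asum_cons, h (x, l) (by simp), zero_add, asum_eq_zero_of_steps A (x + l.vec) w fun s hs => h s (by simp [hs])]

/-- CONGRUENCE for contour sums. [folklore] -/
theorem asum_congr_of_steps (A A' : Site d → Fin d → X) :
    ∀ (x : Site d) (w : List (Letter d)),
      (∀ s ∈ steps x w, stepA A s.1 s.2 = stepA A' s.1 s.2) → asum A x w = asum A' x w
  | _, [], _ => rfl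
  | x, l :: w, h => by
    rw [asum_cons, asum_cons, h (x, l) (by simp), asum_congr_of_steps A A' (x + l.vec) w fun s hs =>
      h s (by simp [hs])]

end Additive

/-- The bonds of a forward segment: `seg κ n` read from `x` traverses the bonds `⟨x + t e_κ, +e_κ⟩`, `t < n`. [folklore] -/
theorem mem_steps_seg (κ : Fin d) :
    ∀ (n : ℕ) (x : Site d) (s : Site d × Letter d),
      s ∈ steps x (seg κ n) → ∃ t : ℕ, t < n ∧ s = (x + (t : ℤ) • e κ, (κ, true))
  | 0, _, _, h => by simp at h
  | n + 1, x, s, h => by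
    rw [seg_natCast, List.replicate_succ, steps_cons, List.mem_cons, Letter.vec_true, ← seg_natCast] at h
    rcases h with rfl | h
    · exact ⟨0, by omega, by simp⟩
    · obtain ⟨t, ht, rfl⟩ := mem_steps_seg κ n (x + e κ) s h
      refine ⟨t + 1, by omega, ?_⟩
      rw [Nat.cast_succ, add_smul, one_smul, ← add_assoc, add_right_comm]

/-- THE TREE CONTOUR STAYS IN ITS BOX: for `v ≥ 0`, every bond traversed by `treeWord v` read from `x` is a forward bond
`⟨y, y + e_κ⟩` with `x ≤ y` and `y + e_κ ≤ x + v` (coordinatewise).  (General form over a duplicate-free list of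
directions, the box shrinking as directions are used up.) [folklore] -/
theorem mem_steps_flatMap_seg :
    ∀ (ks : List (Fin d)), ks.Nodup → ∀ (x v : Site d), (∀ κ, 0 ≤ v κ) →
      ∀ s ∈ steps x (ks.flatMap fun κ => seg κ (v κ)),
        ∃ (y : Site d) (κ : Fin d), s = (y, (κ, true)) ∧ x ≤ y ∧ y + e κ ≤ x + v
  | [], _, _, _, _, s, hs => by simp at hs
  | k :: ks, hnd, x, v, hv, s, hs => by
    rw [List.nodup_cons] at hnd
    rw [List.flatMap_cons, steps_append, List.mem_append] at hs
    obtain ⟨m, hm⟩ := Int.eq_ofNat_of_zero_le (hv k)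
    rcases hs with hs | hs
    · rw [hm] at hs
      obtain ⟨t, ht, rfl⟩ := mem_steps_seg k m x s hs
      refine ⟨_, k, rfl, ?_, ?_⟩
      · intro i
        simp only [Pi.add_apply, Pi.smul_apply, smul_eq_mul, e_apply]
        split_ifs <;> simp
      · intro i
        simp only [Pi.add_apply, Pi.smul_apply, smul_eq_mul, e_apply]
        split_ifs with hi
        · subst hi; rw [hm]; omega
        · simp only [mul_zero, add_zero]; linarith [hv i]
    · -- the remaining directions, from `x + v_k e_k`, inside the box `[x + v_k e_k, x + v]`
      set v' : Site d := v - v k • e k with hv'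
      have hfm : (ks.flatMap fun κ => seg κ (v κ)) = ks.flatMap fun κ => seg κ (v' κ) := by
        refine List.flatMap_congr ?_
        intro κ hκ
        have hne : κ ≠ k := fun h => hnd.1 (h ▸ hκ)
        simp [hv', e_apply, hne]
      rw [hfm, disp_seg] at hs
      have hv'0 : ∀ κ, 0 ≤ v' κ := fun κ => by
        simp only [hv', Pi.sub_apply, Pi.smul_apply, smul_eq_mul, e_apply]
        split_ifs with h
        · subst h; simp
        · simp [hv κ]
      obtain ⟨y, κ, rfl, hy, hy'⟩ := mem_steps_flatMap_seg ks hnd.2 (x + v k • e k) v' hv'0 s hs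
      refine ⟨y, κ, rfl, le_trans ?_ hy, hy'.trans (le_of_eq ?_)⟩
      · intro i
        simp only [Pi.add_apply, Pi.smul_apply, smul_eq_mul, e_apply]
        split_ifs with hi
        · subst hi; simpa using hv i
        · simp
      · rw [hv', add_assoc, add_sub_cancel]

/-- The tree contour `treeWord v` (`v ≥ 0`) read from `x` traverses only forward bonds inside the box `[x, x + v]`.
[folklore] -/
theorem mem_steps_treeWord (x v : Site d) (hv : ∀ κ, 0 ≤ v κ) (s : Site d × Letter d)
    (hs : s ∈ steps x (treeWord v)) : ∃ (y : Site d) (κ : Fin d), s = (y, (κ, true)) ∧ x ≤ y ∧ y + e κ ≤ x + v :=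
  mem_steps_flatMap_seg _ (List.nodup_reverse.2 (List.nodup_finRange d)) x v hv s hs

/-! ## §3 The slice pullback of a coarse configuration, and the slice lift of a coarse cochain -/

section Pull

variable {G : Type*} [Group G]

/-- THE SLICE PULLBACK of a coarse configuration `U` to the `L`-times finer lattice: the fine bond `⟨y, y + e_μ⟩` carries
`U ⌊y/L⌋ μ` if it is the last bond of its block in direction `μ` (it crosses from block `⌊y/L⌋` into block `⌊y/L⌋ + e_μ`),
and `1` otherwise — the pullback of `U` along the block map. [folklore] -/
def slicePull (L : ℕ) (U : Site d → Fin d → G) : Site d → Fin d → G :=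
  fun y μ => if res L y μ = (L : ℤ) - 1 then U (blk L y) μ else 1

/-- Off the last slice the pullback is trivial. [folklore] -/
theorem slicePull_of_ne {L : ℕ} (U : Site d → Fin d → G) {y : Site d} {μ : Fin d} (h : res L y μ ≠ (L : ℤ) - 1) :
    slicePull L U y μ = 1 := if_neg h

/-- On the last slice the pullback is the coarse bond variable. [folklore] -/
theorem slicePull_of_eq {L : ℕ} (U : Site d → Fin d → G) {y : Site d} {μ : Fin d} (h : res L y μ = (L : ℤ) - 1) :
    slicePull L U y μ = U (blk L y) μ := if_pos h

/-- The slice pullback is periodic with period `L·P` when `U` is periodic with period `P` (in the sense of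
`B7`-configurations: `U (z + P e_κ) μ = U z μ`). [folklore] -/
theorem slicePull_add_period {L : ℕ} (hL : 1 ≤ L) (U : Site d → Fin d → G) {P : ℤ}
    (hU : ∀ (z : Site d) (κ μ : Fin d), U (z + P • e κ) μ = U z μ) (y : Site d) (κ μ : Fin d) :
    slicePull L U (y + ((L : ℤ) * P) • e κ) μ = slicePull L U y μ := by
  obtain ⟨hb, hr⟩ := blk_res_add_period hL y P κ
  simp only [slicePull, hr, hb, hU]

end Pull

section Lift

variable {X : Type*} [AddCommGroup X]

/-- THE SLICE LIFT of a coarse cochain `ψ`: the value `ψ ⌊y/L⌋ μ` on the last-slice bonds, `0` elsewhere (the additive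
twin of `slicePull`). [folklore] -/
def sliceLift (L : ℕ) (ψ : Site d → Fin d → X) : Site d → Fin d → X :=
  fun y μ => if res L y μ = (L : ℤ) - 1 then ψ (blk L y) μ else 0

/-- Off the last slice the lift vanishes. [folklore] -/
theorem sliceLift_of_ne {L : ℕ} (ψ : Site d → Fin d → X) {y : Site d} {μ : Fin d} (h : res L y μ ≠ (L : ℤ) - 1) :
    sliceLift L ψ y μ = 0 := if_neg h

/-- On the last slice the lift is the coarse value. [folklore] -/
theorem sliceLift_of_eq {L : ℕ} (ψ : Site d → Fin d → X) {y : Site d} {μ : Fin d} (h : res L y μ = (L : ℤ) - 1) :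
    sliceLift L ψ y μ = ψ (blk L y) μ := if_pos h

/-- Periodicity of the slice lift. [folklore] -/
theorem sliceLift_add_period {L : ℕ} (hL : 1 ≤ L) (ψ : Site d → Fin d → X) {P : ℤ}
    (hψ : ∀ (z : Site d) (κ μ : Fin d), ψ (z + P • e κ) μ = ψ z μ) (y : Site d) (κ μ : Fin d) :
    sliceLift L ψ (y + ((L : ℤ) * P) • e κ) μ = sliceLift L ψ y μ := by
  obtain ⟨hb, hr⟩ := blk_res_add_period hL y P κ
  simp only [sliceLift, hr, hb, hψ]

end Lift

end

end Summit.QuantumFields.BalabanUV.T4Continuum.SmoothRefineBlocks
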